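import Summits.Ventures.CertifiedQuantumChemistry.Rows.OrbitalRotationRows
import Summits.Ventures.CertifiedQuantumChemistry.Rows.ObservableRows
import HarnessLib

/-!
# Ventures/CertifiedQuantumChemistry — Rows/ExactOrbitalRotation.lean: EXACT-RATIONAL ORBITAL
# ROTATIONS OF A MODEL FILE and the VARIATIONAL-ROTATION (VR) DIFFERENCE CERTIFICATE of door M4 —
# a `dE-direct:d` pencil leg run on an exactly ROTATED partner file bounds `E₀(A) − E₀(B)`

HONEST FRAMING (verbatim, page 1 of every file of the cell): certified bounds for a stated model
Hamiltonian in a stated basis; not a claim about the real molecule or material beyond that model.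
CERTIFIED = inequalities on `E₀` (or `ΔE₀`) of files pinned by sha256 from replayed exact certificates
with typed soundness lemmas; VALIDATED = everything mapping model → reality.

Typer chem-type-02 (LADDER-CHEM cell chem-oracle, I-TYPE; director-chem g2 2026-08-26T23:54:15Z door
M4, chem-lead rulings A11 (1) and A15 (2) 2026-08-27: «FILE 1 = the rotated-partner soundness —
`IsExactOrbitalRotation u` (uᵀu = 1 over ℚ) + «F′ = rotate u F (tables transformed exactly) ⇒
E₀(F′; sector) = E₀(F; sector)» … so that DifferencePencilRows apply VERBATIM to (F_A, F_B(u))»;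
certificate recipe of chem-solver-6 2026-08-27T00:47:36Z). Zero compute; two small DEFINITIONS
(`Model.IsExactOrbitalRotation`, `Model.rotate`) and soundness THEOREMS; nothing is asserted about any
deposited file; no claim node, no instance, no notation.

WHY. The variational principle admits ANY trial state for `Ĥ_B`, in particular `Ûψ_A` for an
orbital rotation `Û` of the ground state `ψ_A` of `Ĥ_A`: `E₀(B) ≤ ⟨Ûψ_A|Ĥ_B|Ûψ_A⟩ = ⟨ψ_A|Ĥ[F_B(u)]|ψ_A⟩`,
`F_B(u)` = the file whose integral tables are `F_B`'s tables ROTATED by `u` — again an exact-rational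
file when `u` is an exact-rational orthogonal matrix (chem-solver-6: `u = Cayley(A)`, `A` dyadic
antisymmetric). Hence a `dE-direct:d` pencil leg `ℓ ≤ E₀((μ+1)F_A − F_B(u))` plus an upper row
`E₀(A) ≤ u_A` certify `E₀(A) − E₀(B) = E₀(A) − E₀(B(u)) ≥ ℓ − μu_A`: the pencil row of
`Rows/DifferencePencilRows.lean` applied VERBATIM to `(F_A, F_B(u))`, composed with the EXACT INVARIANCE
`E₀(F_B(u); a, b) = E₀(F_B; a, b)` (unitary equivalence of the second-quantised Hamiltonian under a
one-particle basis change: the tree's `Model.energy_conj_orbital`, seat rdm-B, CITED, not re-derived).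
The floor drops to the correlation-only residual `min_u ⟨Ûψ_A|Ĥ_B|Ûψ_A⟩ − E₀(B)`; no `E″`, no λ-grid,
no perturbation hypothesis; readers A/B unchanged; rounding `A` costs tightness only, never soundness.

WHAT. §1 `Model.IsExactOrbitalRotation u` (`uᵀu = 1` over `ℚ`, decides on a literal), `Model.rotate u F`
(HJO (3.2.1): `h′_ab = Σ_pq u_pa u_qb h_pq`, `eri′_abcd = Σ u_pa u_qb u_rc u_sd eri_pqrs`, `E_core` kept),
`rotate_isSymmetric`. §2 `Model.energy_rotate`, `Model.singletEnergy_rotate` and the row transports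
(`lowerRow_rotate_iff`, …, `diffLowerRow_rotate_right_iff`, `diffUpperRow_rotate_left_iff`, …).
§3 scaled pencil rows for integer-rescaled combined files: `Model.energy_lincomb_neg_le`
(`E₀(αF − βG) ≤ αE₀(F) − βE₀(G)`, `β ≥ 0`), `diffLowerRow_of_scaledPencil_of_upperRow` (`0 < β ≤ α`:
`(ℓ − (α−β)u_A)/β ≤ E₀(A) − E₀(B)`; `(α, β) = ((μ+1)N, N)` reads «bound ÷ N»), upper twin.
§4 the VR cells `diffLowerRow_of_rotated_pencil`, `diffUpperRow_of_rotated_pencil`,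
`diffBracket_of_rotated_pencils`, the rescaled forms and the CLAIM-NODE forms
`diff{Lower,Upper}Row_of_scaled_rotated_pencil_certificates` (literal combined file `K` identified with
`lincomb α (−β) F_A (rotate u F_B)` by `Model.ext'`, `LowerCertificate K`, `UpperCertificate F_A`,
literal `u` with `IsExactOrbitalRotation u`). NOT here: the choice of `u` (chem-solver-6's `rotate`
tool), any instance or number, whether VR beats the plain pencil (chem-idea-2's STEP-0 `κ_VR`), the
`s_K` chain (A15: only if it wins STEP-0).

References: T. Helgaker, P. Jørgensen, J. Olsen, *Molecular Electronic-Structure Theory* (Wiley 2000)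
eq. (3.2.1) «φ̃_P = Σ_Q φ_Q U_QP», eq. (3.1.23) «QᵀQ = QQᵀ = 1» [cite: HelgakerJorgensenOlsen2000,
eqs. (3.2.1), (3.1.23)] [galaxy:panama:215530048847934 chunks p0111 L36–L44, p0108 L36–L40, opened by
chem-type-02]; W. Thirring, *Quantum Mathematical Physics* (2002) (3.5.20; 1) (any trial state bounds
`E₁` from above) [cite: Thirring2002QMP, (3.5.20; 1)]; Horn–Johnson (2013) (4.3.16) (the pencil step,
as in `Rows/DifferencePencilRows.lean`). In-house: chem-solver-6 INBOX 2026-08-27T00:47:36Z, chem-lead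
A15 (2). Tree (REUSED, not restated): `Model.energy_conj_orbital`, `Model.singletEnergy_conj_orbital`
(`Rows/OrbitalRotationRows`); `Model.lincomb`, `Model.re_rayleigh_lincomb`, `Model.lincomb_isSymmetric`,
`Model.exists_isGroundState`, `IsGroundState.energy_mul_le_re_rayleigh`,
`diffLowerRow_of_pencil_of_upperRow`, `diffUpperRow_of_pencil_of_upperRow`,
`diffLowerRow_iff_diffUpperRow_swap`, `lowerRow_of_certificate`, `upperRow_of_certificate`.
-/

noncomputable section

namespace Summit.Ventures.CertifiedQuantumChemistry

open Matrix Finset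
open Literature.MathematicalPhysics.QuantumLattice Literature.MathematicalPhysics.QuantumChemistry
open scoped ComplexOrder

/-! ## §1 Exact-rational orbital rotations of a model file -/

namespace Model

variable {k : ℕ}

/-- **`u` is an EXACT ORBITAL ROTATION**: a rational `k × k` matrix with `uᵀ·u = 1` (a real
orthogonal matrix, HJO (3.1.23) «QᵀQ = QQᵀ = 1», read over `ℚ` so that the predicate DECIDES on a
literal matrix — e.g. a signed permutation, or chem-solver-6's Cayley transform `(1 − A)⁻¹(1 + A)` of a
dyadic antisymmetric `A`). [cite: HelgakerJorgensenOlsen2000, eq. (3.1.23)] -/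
def IsExactOrbitalRotation (u : Matrix (Fin k) (Fin k) ℚ) : Prop :=
  uᵀ * u = 1

/-- **The ROTATED model file `rotate u F`**: the integral tables of `F` in the orbital basis
`φ̃_a = Σ_p φ_p u_pa` (HJO (3.2.1) «φ̃_P = Σ_Q φ_Q U_QP», real `u`): `h′_ab = Σ_pq u_pa u_qb h_pq`,
`(ab|cd)′ = Σ_pqrs u_pa u_qb u_rc u_sd (pq|rs)`, `E_core′ = E_core` — exact rational tables again (the
object a producer writes, up to an integer rescale, as the ROTATED PARTNER FILE of a VR certificate).
[cite: HelgakerJorgensenOlsen2000, eq. (3.2.1)] -/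
def rotate (u : Matrix (Fin k) (Fin k) ℚ) (F : Model k) : Model k where
  h a b := ∑ p, ∑ q, u p a * u q b * F.h p q
  eri a b c d := ∑ p, ∑ q, ∑ r, ∑ s, u p a * u q b * u r c * u s d * F.eri p q r s
  ecore := F.ecore

/-- One-electron table of the rotated file (by definition). -/
@[simp] theorem rotate_h (u : Matrix (Fin k) (Fin k) ℚ) (F : Model k) (a b : Fin k) :
    (rotate u F).h a b = ∑ p, ∑ q, u p a * u q b * F.h p q := rfl

/-- Two-electron table of the rotated file (by definition). -/
@[simp] theorem rotate_eri (u : Matrix (Fin k) (Fin k) ℚ) (F : Model k) (a b c d : Fin k) :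
    (rotate u F).eri a b c d = ∑ p, ∑ q, ∑ r, ∑ s, u p a * u q b * u r c * u s d * F.eri p q r s := rfl

/-- Core constant of the rotated file (unchanged, by definition). -/
@[simp] theorem rotate_ecore (u : Matrix (Fin k) (Fin k) ℚ) (F : Model k) : (rotate u F).ecore = F.ecore := rfl

/-- An exact orbital rotation also satisfies `u·uᵀ = 1` (square matrices). -/
theorem IsExactOrbitalRotation.mul_transpose {u : Matrix (Fin k) (Fin k) ℚ}
    (hu : IsExactOrbitalRotation u) : u * uᵀ = 1 := mul_eq_one_comm.1 hu

/-- The transpose (inverse rotation) of an exact orbital rotation is one. -/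
theorem IsExactOrbitalRotation.transpose {u : Matrix (Fin k) (Fin k) ℚ}
    (hu : IsExactOrbitalRotation u) : IsExactOrbitalRotation uᵀ := by
  unfold IsExactOrbitalRotation
  rw [transpose_transpose]
  exact hu.mul_transpose

/-- **Rotation preserves the integral symmetries**: if `F.IsSymmetric` (`h` symmetric,
`(pq|rs) = (qp|sr)`) then so is `rotate u F` (relabel the summation `(p, q, r, s) ↦ (q, p, s, r)`). -/
theorem rotate_isSymmetric {F : Model k} (hF : F.IsSymmetric) (u : Matrix (Fin k) (Fin k) ℚ) :
    (rotate u F).IsSymmetric := by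
  refine ⟨fun a b => ?_, fun a b c d => ?_⟩
  · simp only [rotate_h]
    rw [Finset.sum_comm]
    refine Finset.sum_congr rfl fun q _ => Finset.sum_congr rfl fun p _ => ?_
    rw [hF.1 q p]
    ring
  · simp only [rotate_eri]
    rw [Finset.sum_comm]
    refine Finset.sum_congr rfl fun q _ => Finset.sum_congr rfl fun p _ => ?_
    rw [Finset.sum_comm]
    refine Finset.sum_congr rfl fun s _ => Finset.sum_congr rfl fun r _ => ?_
    rw [hF.2 q p s r]
    ring

/-! ## §2 Exact invariance of the certified quantities and transport of the row predicates -/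

/-- The complexified rotation `u ↦ (u_pq : ℂ)` of an exact orbital rotation is unitary:
`u_ℂ · u_ℂ† = 1`. -/
theorem IsExactOrbitalRotation.map_mul_conjTranspose {u : Matrix (Fin k) (Fin k) ℚ}
    (hu : IsExactOrbitalRotation u) :
    u.map (Rat.castHom ℂ) * (u.map (Rat.castHom ℂ))ᴴ = 1 := by
  have hT : (u.map (Rat.castHom ℂ))ᴴ = uᵀ.map (Rat.castHom ℂ) := by
    ext i j
    simp only [conjTranspose_apply, map_apply, transpose_apply, Rat.coe_castHom, Complex.star_def,
      map_ratCast]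
  rw [hT, ← Matrix.map_mul, hu.mul_transpose, Matrix.map_one (Rat.castHom ℂ) (map_zero _) (map_one _)]

/-- The complexified one-electron table of `rotate u F` is the rotated complexified table (the
hypothesis `hh` of rdm-B's `Model.energy_conj_orbital`, discharged). -/
theorem rotate_h_cast (u : Matrix (Fin k) (Fin k) ℚ) (F : Model k) (a b : Fin k) :
    (((rotate u F).h a b : ℚ) : ℂ) =
      ∑ p, ∑ q, u.map (Rat.castHom ℂ) p a * star (u.map (Rat.castHom ℂ) q b) * (F.h p q : ℂ) := by
  simp only [rotate_h, map_apply, Rat.coe_castHom, Complex.star_def, map_ratCast]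
  push_cast
  rfl

/-- The complexified two-electron table of `rotate u F` is the rotated complexified table (the
hypothesis `hg` of rdm-B's `Model.energy_conj_orbital`, discharged). -/
theorem rotate_eri_cast (u : Matrix (Fin k) (Fin k) ℚ) (F : Model k) (a b c d : Fin k) :
    (((rotate u F).eri a b c d : ℚ) : ℂ) =
      ∑ p, ∑ q, ∑ r, ∑ s, u.map (Rat.castHom ℂ) p a * star (u.map (Rat.castHom ℂ) q b) *
        u.map (Rat.castHom ℂ) r c * star (u.map (Rat.castHom ℂ) s d) * (F.eri p q r s : ℂ) := by
  simp only [rotate_eri, map_apply, Rat.coe_castHom, Complex.star_def, map_ratCast]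
  push_cast
  rfl

/-- **THE CERTIFIED QUANTITY IS INVARIANT UNDER EXACT ORBITAL ROTATIONS**:
`E₀(rotate u F; a, b) = E₀(F; a, b)` in every sector, for every exact orbital rotation `u` (no symmetry
hypothesis on `F`). Unitary equivalence `Γ(Ū)† Ĥ_F Γ(Ū) = Ĥ_{rotate u F}` of the second-quantised
Hamiltonian under the one-particle basis change (3.2.1) — the tree's `Model.energy_conj_orbital`
(seat rdm-B), whose complex-unitary and rotated-table hypotheses are discharged from `uᵀu = 1`.
[cite: HelgakerJorgensenOlsen2000, eq. (3.2.1)] -/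
theorem energy_rotate {u : Matrix (Fin k) (Fin k) ℚ} (hu : IsExactOrbitalRotation u) (F : Model k)
    (a b : ℕ) : (rotate u F).energy a b = F.energy a b :=
  Model.energy_conj_orbital hu.map_mul_conjTranspose (rotate_h_cast u F) (rotate_eri_cast u F) rfl a b

/-- **The SINGLET quantity is invariant under exact orbital rotations**:
`(rotate u F).singletEnergy n = F.singletEnergy n` (rdm-B's `Model.singletEnergy_conj_orbital`).
[cite: HelgakerJorgensenOlsen2000, eq. (3.2.1)] -/
theorem singletEnergy_rotate {u : Matrix (Fin k) (Fin k) ℚ} (hu : IsExactOrbitalRotation u)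
    (F : Model k) (n : ℕ) : (rotate u F).singletEnergy n = F.singletEnergy n :=
  Model.singletEnergy_conj_orbital hu.map_mul_conjTranspose (rotate_h_cast u F) (rotate_eri_cast u F)
    rfl n

end Model

section Transport

variable {k k' : ℕ} {u : Matrix (Fin k) (Fin k) ℚ}

/-- **LOWER rows transport under exact orbital rotations** (`LowerRow (rotate u F) ↔ LowerRow F`). -/
theorem lowerRow_rotate_iff (hu : Model.IsExactOrbitalRotation u) (F : Model k) (a b : ℕ) (lo : ℚ) :
    LowerRow (Model.rotate u F) a b lo ↔ LowerRow F a b lo := by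
  unfold LowerRow
  rw [Model.energy_rotate hu]

/-- **UPPER rows transport under exact orbital rotations** (`UpperRow (rotate u F) ↔ UpperRow F`). -/
theorem upperRow_rotate_iff (hu : Model.IsExactOrbitalRotation u) (F : Model k) (a b : ℕ) (hi : ℚ) :
    UpperRow (Model.rotate u F) a b hi ↔ UpperRow F a b hi := by
  unfold UpperRow
  rw [Model.energy_rotate hu]

/-- **Brackets transport under exact orbital rotations.** -/
theorem bracket_rotate_iff (hu : Model.IsExactOrbitalRotation u) (F : Model k) (a b : ℕ)
    (lo hi : ℚ) : Bracket (Model.rotate u F) a b lo hi ↔ Bracket F a b lo hi := by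
  unfold Bracket
  rw [lowerRow_rotate_iff hu, upperRow_rotate_iff hu]

/-- **Difference LOWER rows transport under an exact rotation of the RIGHT file**:
`DiffLowerRow F_A a b (rotate u F_B) a′ b′ lo ↔ DiffLowerRow F_A a b F_B a′ b′ lo`. -/
theorem diffLowerRow_rotate_right_iff (hu : Model.IsExactOrbitalRotation u) (FA : Model k')
    (a b : ℕ) (FB : Model k) (a' b' : ℕ) (lo : ℚ) :
    DiffLowerRow FA a b (Model.rotate u FB) a' b' lo ↔ DiffLowerRow FA a b FB a' b' lo := by
  unfold DiffLowerRow
  rw [Model.energy_rotate hu]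

/-- **Difference LOWER rows transport under an exact rotation of the LEFT file.** -/
theorem diffLowerRow_rotate_left_iff (hu : Model.IsExactOrbitalRotation u) (FA : Model k)
    (a b : ℕ) (FB : Model k') (a' b' : ℕ) (lo : ℚ) :
    DiffLowerRow (Model.rotate u FA) a b FB a' b' lo ↔ DiffLowerRow FA a b FB a' b' lo := by
  unfold DiffLowerRow
  rw [Model.energy_rotate hu]

/-- **Difference UPPER rows transport under an exact rotation of the RIGHT file.** -/
theorem diffUpperRow_rotate_right_iff (hu : Model.IsExactOrbitalRotation u) (FA : Model k')
    (a b : ℕ) (FB : Model k) (a' b' : ℕ) (hi : ℚ) :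
    DiffUpperRow FA a b (Model.rotate u FB) a' b' hi ↔ DiffUpperRow FA a b FB a' b' hi := by
  unfold DiffUpperRow
  rw [Model.energy_rotate hu]

/-- **Difference UPPER rows transport under an exact rotation of the LEFT file.** -/
theorem diffUpperRow_rotate_left_iff (hu : Model.IsExactOrbitalRotation u) (FA : Model k)
    (a b : ℕ) (FB : Model k') (a' b' : ℕ) (hi : ℚ) :
    DiffUpperRow (Model.rotate u FA) a b FB a' b' hi ↔ DiffUpperRow FA a b FB a' b' hi := by
  unfold DiffUpperRow
  rw [Model.energy_rotate hu]

end Transport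

/-! ## §3 Scaled pencil rows (integer-rescaled combined files) -/

section ScaledPencil

variable {k : ℕ}

/-- **The pencil inequality with two coefficients**: for symmetric `F`, `G`, a physical sector
`a, b ≤ k`, any rational `α` and any `β ≥ 0`: `E₀(α·F − β·G; a, b) ≤ α·E₀(F; a, b) − β·E₀(G; a, b)`
(the sector ground state `ψ` of `Ĥ(F)` is a trial state for `Ĥ(αF − βG)` — `Re⟨ψ, Ĥ(αF − βG)ψ⟩ =
αE₀(F) − βRe⟨ψ, Ĥ(G)ψ⟩` — and for `Ĥ(G)`, `E₀(G) ≤ Re⟨ψ, Ĥ(G)ψ⟩`, weighted by `β ≥ 0`).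
Thirring (2002) (3.5.20; 1); Horn–Johnson (4.3.16) at `β = 1` (`Model.energy_pencil_le`).
[cite: Thirring2002QMP, (3.5.20; 1)] -/
theorem Model.energy_lincomb_neg_le {F G : Model k} (hF : F.IsSymmetric) (hG : G.IsSymmetric)
    {a b : ℕ} (ha : a ≤ k) (hb : b ≤ k) (α : ℚ) {β : ℚ} (hβ : 0 ≤ β) :
    (Model.lincomb α (-β) F G).energy a b ≤ (α : ℝ) * F.energy a b - (β : ℝ) * G.energy a b := by
  obtain ⟨ψ, hψ, hψ1⟩ := Model.exists_isGroundState hF ha hb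
  have hn : (star ψ ⬝ᵥ ψ).re = 1 := by rw [hψ1, Complex.one_re]
  have hK := hψ.energy_mul_le_re_rayleigh (Model.lincomb_isSymmetric hF hG (α := α) (β := -β))
  rw [Model.re_rayleigh_lincomb, hψ.2.2, hn, mul_one, mul_one, Rat.cast_neg] at hK
  have hGv := hψ.energy_mul_le_re_rayleigh hG
  rw [hn, mul_one] at hGv
  have hβ' : (0 : ℝ) ≤ (β : ℝ) := by exact_mod_cast hβ
  nlinarith [mul_le_mul_of_nonneg_left hGv hβ']

/-- **Scaled `dE-direct:d`, LOWER side.** For symmetric `F_A`, `F_B`, coefficients `0 < β ≤ α`, a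
certified lower row `ℓ ≤ E₀(α·F_A − β·F_B; a, b)` of the combined file and a certified upper row
`E₀(A) ≤ u_A`: `(ℓ − (α − β)·u_A)/β ≤ E₀(A) − E₀(B)`. With `(α, β) = (c, 1)` this is
`diffLowerRow_of_pencil_of_upperRow`; with `(α, β) = ((μ+1)N, N)` (a combined file rescaled by an
integer `N` so that its literals are finite decimals — chem-solver-6's recipe) it reads
`ℓ/N − μ·u_A ≤ E₀(A) − E₀(B)` («bound ÷ N in exact ℚ»). [cite: Thirring2002QMP, (3.5.20; 1)] -/
theorem diffLowerRow_of_scaledPencil_of_upperRow {FA FB : Model k} (hA : FA.IsSymmetric)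
    (hB : FB.IsSymmetric) {a b : ℕ} {α β ℓ uA : ℚ} (hβ : 0 < β) (hαβ : β ≤ α)
    (hP : LowerRow (Model.lincomb α (-β) FA FB) a b ℓ) (hU : UpperRow FA a b uA) :
    DiffLowerRow FA a b FB a b ((ℓ - (α - β) * uA) / β) := by
  obtain ⟨ha, hb, hℓ⟩ := hP
  have hpen := Model.energy_lincomb_neg_le hA hB ha hb α hβ.le
  have hu := hU.le
  have hc' : (0 : ℝ) ≤ (α : ℝ) - (β : ℝ) := by exact_mod_cast sub_nonneg.2 hαβ
  have hmul := mul_le_mul_of_nonneg_left hu hc'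
  have hβ' : (0 : ℝ) < (β : ℝ) := by exact_mod_cast hβ
  refine ⟨⟨ha, hb⟩, ⟨ha, hb⟩, ?_⟩
  push_cast
  rw [div_le_iff₀ hβ']
  nlinarith

/-- **Scaled `dE-direct:d`, UPPER side** (roles of `A` and `B` exchanged): `0 < β ≤ α`, a certified
lower row `ℓ ≤ E₀(α·F_B − β·F_A; a, b)` and an upper row `E₀(B) ≤ u_B` give
`E₀(A) − E₀(B) ≤ ((α − β)·u_B − ℓ)/β`. [cite: Thirring2002QMP, (3.5.20; 1)] -/
theorem diffUpperRow_of_scaledPencil_of_upperRow {FA FB : Model k} (hA : FA.IsSymmetric)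
    (hB : FB.IsSymmetric) {a b : ℕ} {α β ℓ uB : ℚ} (hβ : 0 < β) (hαβ : β ≤ α)
    (hP : LowerRow (Model.lincomb α (-β) FB FA) a b ℓ) (hU : UpperRow FB a b uB) :
    DiffUpperRow FA a b FB a b (((α - β) * uB - ℓ) / β) := by
  have h := (diffLowerRow_iff_diffUpperRow_swap FB a b FA a b _).1
    (diffLowerRow_of_scaledPencil_of_upperRow hB hA hβ hαβ hP hU)
  have e : -((ℓ - (α - β) * uB) / β) = ((α - β) * uB - ℓ) / β := by ring
  rwa [e] at h

end ScaledPencil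

/-! ## §4 The variational-rotation (VR) difference certificate: pencil legs on ROTATED partner files -/

section VariationalRotation

variable {k : ℕ} {u : Matrix (Fin k) (Fin k) ℚ}

/-- **VR certificate, LOWER side** (door M4, chem-solver-6 / chem-lead A15 (2)). For symmetric `F_A`,
`F_B`, an exact orbital rotation `u`, a multiplier `c ≥ 1`, a certified lower row
`ℓ ≤ E₀(c·F_A − rotate u F_B; a, b)` of the combined file built on the ROTATED partner and a certified
upper row `E₀(A) ≤ u_A`: `ℓ − (c − 1)·u_A ≤ E₀(A) − E₀(B)` — `diffLowerRow_of_pencil_of_upperRow` on the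
pair `(F_A, rotate u F_B)` (trial state `Ûψ_A` for `Ĥ_B`) composed with `E₀(rotate u F_B) = E₀(F_B)`.
Valid for EVERY exact rotation `u`; its quality (the correlation-only floor) is the producer's business.
[cite: Thirring2002QMP, (3.5.20; 1)] -/
theorem diffLowerRow_of_rotated_pencil {FA FB : Model k} (hA : FA.IsSymmetric) (hB : FB.IsSymmetric)
    (hu : Model.IsExactOrbitalRotation u) {a b : ℕ} {c ℓ uA : ℚ} (hc : 1 ≤ c)
    (hP : LowerRow (Model.lincomb c (-1) FA (Model.rotate u FB)) a b ℓ) (hU : UpperRow FA a b uA) :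
    DiffLowerRow FA a b FB a b (ℓ - (c - 1) * uA) :=
  (diffLowerRow_rotate_right_iff hu FA a b FB a b _).1
    (diffLowerRow_of_pencil_of_upperRow hA (Model.rotate_isSymmetric hB u) hc hP hU)

/-- **VR certificate, UPPER side**: an exact rotation `u′` of `F_A`, `c ≥ 1`, a certified lower row
`ℓ ≤ E₀(c·F_B − rotate u′ F_A; a, b)` and an upper row `E₀(B) ≤ u_B` give
`E₀(A) − E₀(B) ≤ (c − 1)·u_B − ℓ` (trial state `Û′ψ_B` for `Ĥ_A`). [cite: Thirring2002QMP, (3.5.20; 1)] -/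
theorem diffUpperRow_of_rotated_pencil {FA FB : Model k} (hA : FA.IsSymmetric) (hB : FB.IsSymmetric)
    (hu : Model.IsExactOrbitalRotation u) {a b : ℕ} {c ℓ uB : ℚ} (hc : 1 ≤ c)
    (hP : LowerRow (Model.lincomb c (-1) FB (Model.rotate u FA)) a b ℓ) (hU : UpperRow FB a b uB) :
    DiffUpperRow FA a b FB a b ((c - 1) * uB - ℓ) :=
  (diffUpperRow_rotate_left_iff hu FA a b FB a b _).1
    (diffUpperRow_of_pencil_of_upperRow (Model.rotate_isSymmetric hA u) hB hc hP hU)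

/-- **THE TWO-SIDED VR BRACKET**: rotations `u` (of `F_B`, lower side) and `u′` (of `F_A`, upper side),
multipliers `c_A, c_B ≥ 1`, the two pencil lower rows on the rotated partners and the two upper rows
of `F_A`, `F_B` give `ℓ_A − (c_A − 1)u_A ≤ E₀(A) − E₀(B) ≤ (c_B − 1)u_B − ℓ_B`.
[cite: Thirring2002QMP, (3.5.20; 1)] -/
theorem diffBracket_of_rotated_pencils {FA FB : Model k} (hA : FA.IsSymmetric) (hB : FB.IsSymmetric)
    {u' : Matrix (Fin k) (Fin k) ℚ} (hu : Model.IsExactOrbitalRotation u)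
    (hu' : Model.IsExactOrbitalRotation u') {a b : ℕ} {cA ℓA uA cB ℓB uB : ℚ} (hcA : 1 ≤ cA)
    (hcB : 1 ≤ cB) (hPA : LowerRow (Model.lincomb cA (-1) FA (Model.rotate u FB)) a b ℓA)
    (hUA : UpperRow FA a b uA) (hPB : LowerRow (Model.lincomb cB (-1) FB (Model.rotate u' FA)) a b ℓB)
    (hUB : UpperRow FB a b uB) :
    DiffBracket FA a b FB a b (ℓA - (cA - 1) * uA) ((cB - 1) * uB - ℓB) :=
  ⟨diffLowerRow_of_rotated_pencil hA hB hu hcA hPA hUA,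
    diffUpperRow_of_rotated_pencil hA hB hu' hcB hPB hUB⟩

/-- **VR certificate, LOWER side, INTEGER-RESCALED combined file** (the deposited form: the rotated
tables `rotate u F_B` are rational, the combined file `α·F_A − β·rotate u F_B` with
`(α, β) = ((μ+1)N, N)` has finite-decimal literals): `0 < β ≤ α`, `ℓ ≤ E₀(α·F_A − β·rotate u F_B; a, b)`,
`E₀(A) ≤ u_A` ⊢ `(ℓ − (α − β)u_A)/β ≤ E₀(A) − E₀(B)`. [cite: Thirring2002QMP, (3.5.20; 1)] -/
theorem diffLowerRow_of_scaled_rotated_pencil {FA FB : Model k} (hA : FA.IsSymmetric)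
    (hB : FB.IsSymmetric) (hu : Model.IsExactOrbitalRotation u) {a b : ℕ} {α β ℓ uA : ℚ}
    (hβ : 0 < β) (hαβ : β ≤ α)
    (hP : LowerRow (Model.lincomb α (-β) FA (Model.rotate u FB)) a b ℓ) (hU : UpperRow FA a b uA) :
    DiffLowerRow FA a b FB a b ((ℓ - (α - β) * uA) / β) :=
  (diffLowerRow_rotate_right_iff hu FA a b FB a b _).1
    (diffLowerRow_of_scaledPencil_of_upperRow hA (Model.rotate_isSymmetric hB u) hβ hαβ hP hU)

/-- **VR certificate, UPPER side, integer-rescaled combined file**: `0 < β ≤ α`,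
`ℓ ≤ E₀(α·F_B − β·rotate u′ F_A; a, b)`, `E₀(B) ≤ u_B` ⊢ `E₀(A) − E₀(B) ≤ ((α − β)u_B − ℓ)/β`.
[cite: Thirring2002QMP, (3.5.20; 1)] -/
theorem diffUpperRow_of_scaled_rotated_pencil {FA FB : Model k} (hA : FA.IsSymmetric)
    (hB : FB.IsSymmetric) (hu : Model.IsExactOrbitalRotation u) {a b : ℕ} {α β ℓ uB : ℚ}
    (hβ : 0 < β) (hαβ : β ≤ α)
    (hP : LowerRow (Model.lincomb α (-β) FB (Model.rotate u FA)) a b ℓ) (hU : UpperRow FB a b uB) :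
    DiffUpperRow FA a b FB a b (((α - β) * uB - ℓ) / β) :=
  (diffUpperRow_rotate_left_iff hu FA a b FB a b _).1
    (diffUpperRow_of_scaledPencil_of_upperRow (Model.rotate_isSymmetric hA u) hB hβ hαβ hP hU)

/-- **CLAIM-NODE FORM of the VR lower certificate** (what the files state, every object literal and
pinned): a literal combined file `K` identified with `α·F_A − β·rotate u F_B` (`Model.ext'` +
`decide`/`norm_num` on the rational tables), a literal rational matrix `u` with
`IsExactOrbitalRotation u` (decides), `0 < β ≤ α`, a FORMAT-qcl1 lower certificate
`LowerCertificate K a b ℓ` and a FORMAT-qcu0 upper certificate `UpperCertificate F_A a b u_A` on the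
physical range `a, b ≤ k` give `DiffLowerRow F_A a b F_B a b ((ℓ − (α − β)u_A)/β)`.
[cite: Thirring2002QMP, (3.5.20; 1)] -/
theorem diffLowerRow_of_scaled_rotated_pencil_certificates {FA FB K : Model k} (hA : FA.IsSymmetric)
    (hB : FB.IsSymmetric) (hu : Model.IsExactOrbitalRotation u) {a b : ℕ} (ha : a ≤ k) (hb : b ≤ k)
    {α β ℓ uA : ℚ} (hβ : 0 < β) (hαβ : β ≤ α) (hK : K = Model.lincomb α (-β) FA (Model.rotate u FB))
    (hP : LowerCertificate K a b ℓ) (hU : UpperCertificate FA a b uA) :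
    DiffLowerRow FA a b FB a b ((ℓ - (α - β) * uA) / β) := by
  subst hK
  exact diffLowerRow_of_scaled_rotated_pencil hA hB hu hβ hαβ
    (lowerRow_of_certificate (Model.lincomb_isSymmetric hA (Model.rotate_isSymmetric hB u)) ha hb hP)
    (upperRow_of_certificate hA hU)

/-- **CLAIM-NODE FORM of the VR upper certificate**: `K′ = α·F_B − β·rotate u′ F_A` literal,
`LowerCertificate K′ a b ℓ`, `UpperCertificate F_B a b u_B` ⊢
`DiffUpperRow F_A a b F_B a b (((α − β)u_B − ℓ)/β)`. [cite: Thirring2002QMP, (3.5.20; 1)] -/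
theorem diffUpperRow_of_scaled_rotated_pencil_certificates {FA FB K : Model k} (hA : FA.IsSymmetric)
    (hB : FB.IsSymmetric) (hu : Model.IsExactOrbitalRotation u) {a b : ℕ} (ha : a ≤ k) (hb : b ≤ k)
    {α β ℓ uB : ℚ} (hβ : 0 < β) (hαβ : β ≤ α) (hK : K = Model.lincomb α (-β) FB (Model.rotate u FA))
    (hP : LowerCertificate K a b ℓ) (hU : UpperCertificate FB a b uB) :
    DiffUpperRow FA a b FB a b (((α - β) * uB - ℓ) / β) := by
  subst hK
  exact diffUpperRow_of_scaled_rotated_pencil hA hB hu hβ hαβ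
    (lowerRow_of_certificate (Model.lincomb_isSymmetric hB (Model.rotate_isSymmetric hA u)) ha hb hP)
    (upperRow_of_certificate hB hU)

end VariationalRotation

end Summit.Ventures.CertifiedQuantumChemistry

end
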